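import Summits.ABC.IUTFork.Repair.RHDatumClassHLt4
import Literature.IUT.LogVolume.RescaledCompletionInvariants
import Mathlib.NumberTheory.NumberField.Cyclotomic.Ideal
import HarnessLib

/-!
# D-0079 RESCUE sub-cell R-H, ROUND 1 row 8 (superseded harvested reading «datum-class-H-lt-4») — the UNCONDITIONAL kernel kill:
# `¬ HStarI06OfHeightLt c` for every `c > 2`, by an EXPLICIT inhabited negative cell (the completion of `ℚ(ζ₂₃)` above `23`)

PROOF-ONLY companion (0 definitions, 0 `Prop` facts; seat abc-iut-rh-typ-8 gen 0, R-H ROUND 1 PAIR n = 8 TYPER) of `Repair/RHDatumClassHLt4.lean`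
(p457793): there, reading (a) of the harvested row-8 text — `RH.DatumClassHLt4.HStarI06OfHeightLt c`, «at every bad place of height `H < c` the content
of RP-I06⋆ holds at every label» — was killed at a NAMED table cell GIVEN an inhabitant (`not_hStarI06OfHeightLt_of_cell_7_11`) and at a GENUINE datum
GIVEN a Θ-volume datum `T` (`i06star_topLabel_false_lamOne_l67`). This file removes every hypothesis: it CONSTRUCTS an inhabited negative cell inside
the class and proves **`not_hStarI06OfHeightLt_of_two_lt : 2 < c → ¬ HStarI06OfHeightLt c`** (so `¬ HStarI06OfHeightLt 4`) outright.

THE WITNESS (classical algebraic number theory, nothing IUT-specific): `F = ℚ(ζ₂₃)` (`CyclotomicField 23 ℚ`), its prime `v` over `23` — totally ramified,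
`e(v|23) = 22` (Mathlib `IsCyclotomicExtension.Rat.ramificationIdx_eq_of_prime`) —, the rescaled completion `K = F_v` (abc-iut-S7's
`RescaledCompletion`, a complete nontrivially ultrametric-normed `ℚ₂₃`-algebra with `absRamificationIdx 23 K = 22`,
`absRamificationIdx_rescaledCompletion`), a norm uniformizer `ϖ` with `‖ϖ‖ = 23^{−1/22}` (`exists_isUniformizer_rescaledCompletion`), and `q̲ := ϖ²`:
`‖q̲‖^{22} = 23^{−2}`, i.e. a `2l`-th root Kummer datum with `l = 11`, height `H = 2 < 4`. The TOP-LABEL cell `j = l⋆ = 5` is DECIDED-NEG there: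
`22·(b₂₂ + c) = 22·(2 − 1/22) = 43 < (25 − 1)·2 = 48` (abc-iut-rp-d2's `CandInternal2RealStrata.not_mem_pow_smul_logShell_of_root_lt`, with
`b₂₂ = ⌊log₂₃(23·22/22)⌋ − 1/22 = 1 − 1/22`). HONEST SCOPE: the witness is a local FIELD cell of the class, not a genuine initial Θ-datum (the genuine
kill is `i06star_topLabel_false_lamOne_l67`, modulo the inhabitation of R-W's admissibility type); what is refuted is OUR typed hypothesis (a), never a
statement of print. TAKES NO SIDE on [IUTchIII] Cor. 3.12 or on any author; typed ≠ proved; refuted-AS-TYPED ≠ refuted-in-print. Standard axioms.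
[cite: NeukirchANT1999, Ch. I (10.1), Ch. II Prop. (6.8)] [cite: MochizukiAbsTopIII2015, Def 5.4 (iii) p. 126] [claim: Mochizuki2012, status: disputed]
for the quoted reading of RP-I06⋆.
-/

noncomputable section

open NumberField IsDedekindDomain

namespace Summit.ABC.IUTFork.Repair.RH.DatumClassHLt4

open Set Metric
open scoped Pointwise
open Literature.IUT.LogVolume Literature.NumberTheory.NumberFields Literature.AnabelianGeometry.AbsoluteAnabelian
  Summit.ABC.IUTFork.Repair.CandInternal2RealLabels Summit.ABC.IUTFork.Repair.CandInternal2RealStrata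

/-! ## §1. The exponent at `(p, e) = (23, 22)` and the field-level negative cell -/

/-- `b₂₂ = ⌊log(23·22/22)/log 23⌋ − 1/22 = 1 − 1/22` at `p = 23` ([IUTchIV] Prop. 1.2: `b := ⌊log(p·e/(p−1))/log p⌋ − 1/e`). [claim: Mochizuki2012, status: disputed] -/
theorem logRadiusB_23_22 : logRadiusB 23 22 = 1 - 1 / 22 := by
  have hx : ((23 : ℕ) : ℝ) * ((22 : ℕ) : ℝ) / (((23 : ℕ) : ℝ) - 1) = 23 := by norm_num
  have hfloor : ⌊Real.log (((23 : ℕ) : ℝ) * ((22 : ℕ) : ℝ) / (((23 : ℕ) : ℝ) - 1)) / Real.log ((23 : ℕ) : ℝ)⌋ = 1 := by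
    rw [hx, Int.floor_eq_iff]
    have h23 : (0 : ℝ) < Real.log 23 := Real.log_pos (by norm_num)
    push_cast
    rw [div_self h23.ne']
    norm_num
  rw [logRadiusB, hfloor]; norm_num

section Field23

variable [Fact (Nat.Prime 23)]
variable (K : Type) [NontriviallyNormedField K] [NormedAlgebra ℚ_[23] K] [IsUltrametricDist K] [ProperSpace K]

/-- **The cell `(23, 22, 22, 2, 5)` is DECIDED-NEG**: for every `K/ℚ₂₃` with `e = 22` and every `q̲` with `‖q̲‖^{22} = 23^{−2}` (height `H = 2`, `l = 11`),
`q̲ ∉ q̲^{25}·ℐ_K` (`22·(b₂₂ + 1) = 43 < 48`). [cite: MochizukiAbsTopIII2015, Def 5.4 (iii) p. 126] [claim: Mochizuki2012, status: disputed] -/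
theorem cell_23_22_22_2_25_not_mem (he : absRamificationIdx 23 K = 22) {q : K} (hqN : ‖q‖ ^ 22 = ((23 : ℕ) : ℝ) ^ (-(2 : ℝ))) :
    q ∉ q ^ 25 • logShell (PadicLogOnUnits.ofUnitLog 23 K) := by
  refine not_mem_pow_smul_logShell_of_root_lt 23 K (N := 22) (by norm_num) hqN ?_
  rw [he, pstarExp_of_ne_two (by norm_num), logRadiusB_23_22]; norm_num

end Field23

/-! ## §2. The inhabitant: the completion of `ℚ(ζ₂₃)` above `23` -/

/-- `(23) ⊂ ℤ` is a maximal ideal. [folklore] -/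
theorem span_23_isMaximal : (Ideal.span {(23 : ℤ)}).IsMaximal := by
  have hprime : (Ideal.span {(23 : ℤ)}).IsPrime := by
    rw [Ideal.span_singleton_prime (by norm_num)]
    exact Int.prime_iff_natAbs_prime.2 (by norm_num)
  exact hprime.isMaximal (by simp)

/-- **THE INHABITED NEGATIVE CELL OF THE CLASS.** There exist a prime `p` (namely `23`), a complete nontrivially ultrametric-normed `ℚ_p`-algebra `K`
(the rescaled completion of `ℚ(ζ₂₃)` at its prime over `23`) and `q̲ ∈ K^×` with `‖q̲‖^{2·11} = 23^{−2}` (a `2l`-th-root datum of height `H = 2`, `l = 11`)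
whose top-label cell FAILS: `q̲ ∉ q̲^{5²}·ℐ_K`. Stated directly as the refutation of reading (a) for every bound `c > 2`. Classical ingredients:
`e(v|23) = 22` for `ℚ(ζ₂₃)` (Mathlib `IsCyclotomicExtension.Rat.ramificationIdx_eq_of_prime`), abc-iut-S7's `RescaledCompletion` with
`absRamificationIdx_rescaledCompletion` and `exists_isUniformizer_rescaledCompletion`. [cite: NeukirchANT1999, Ch. I (10.1), Ch. II Prop. (6.8)]
[claim: Mochizuki2012, status: disputed] for the refuted reading. -/
theorem not_hStarI06OfHeightLt_of_two_lt {c : ℝ} (hc : 2 < c) : ¬ HStarI06OfHeightLt c := by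
  haveI h23 : Fact (Nat.Prime 23) := ⟨by norm_num⟩
  -- the field `ℚ(ζ₂₃)` (the generic instance needs `NeZero ((23 : ℕ) : ℚ)`, supplied here as in the tree's other cyclotomic instances)
  haveI : IsCyclotomicExtension {23} ℚ (CyclotomicField 23 ℚ) := CyclotomicField.isCyclotomicExtension 23 ℚ
  -- a prime `P` of its integers over `(23)`
  haveI := span_23_isMaximal
  obtain ⟨P, hPmax, hPover⟩ :=
    Ideal.exists_maximal_ideal_liesOver_of_isIntegral (S := 𝓞 (CyclotomicField 23 ℚ)) (Ideal.span {(23 : ℤ)})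
  haveI := hPover
  haveI : P.IsPrime := hPmax.isPrime
  have hp0 : Ideal.span {(23 : ℤ)} ≠ ⊥ := by simp
  have hP0 : P ≠ ⊥ := Ideal.ne_bot_of_liesOver_of_ne_bot hp0 P
  -- as a height-one prime `v`, with `23 ∈ v`
  let v : HeightOneSpectrum (𝓞 (CyclotomicField 23 ℚ)) := ⟨P, hPmax.isPrime, hP0⟩
  have hv : ((23 : ℕ) : 𝓞 (CyclotomicField 23 ℚ)) ∈ v.asIdeal := by
    have h1 : (23 : ℤ) ∈ P.under ℤ := by
      rw [← Ideal.LiesOver.over (P := P) (p := Ideal.span {(23 : ℤ)})]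
      exact Ideal.mem_span_singleton_self _
    rw [Ideal.mem_comap] at h1
    simpa using h1
  -- its ramification index is `22`
  have he : v.asIdeal.ramificationIdx ℤ = 22 := by
    have h := IsCyclotomicExtension.Rat.ramificationIdx_eq_of_prime 23 (CyclotomicField 23 ℚ) P
    simpa using h
  -- the rescaled completion `K = F_v` and a norm uniformizer
  have heK : absRamificationIdx 23 (RescaledCompletion (CyclotomicField 23 ℚ) 23 v hv) = 22 := by
    rw [absRamificationIdx_rescaledCompletion, he]
  obtain ⟨ϖ, -, hϖ⟩ := exists_isUniformizer_rescaledCompletion (CyclotomicField 23 ℚ) 23 v hv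
  rw [he] at hϖ
  -- `q̲ := ϖ²`: `‖q̲‖^{22} = 23^{−2}`
  set q : RescaledCompletion (CyclotomicField 23 ℚ) 23 v hv := (ϖ : RescaledCompletion (CyclotomicField 23 ℚ) 23 v hv) ^ 2 with hqdef
  have hq0 : q ≠ 0 := pow_ne_zero 2 ϖ.ne_zero
  have hqN : ‖q‖ ^ (2 * (2 * 5 + 1)) = ((23 : ℕ) : ℝ) ^ (-(2 : ℝ)) := by
    have h0 : (0 : ℝ) ≤ (23 : ℝ) := by norm_num
    rw [hqdef, norm_pow, hϖ]
    push_cast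
    rw [← Real.rpow_natCast, ← Real.rpow_natCast, ← Real.rpow_mul h0, ← Real.rpow_mul h0]
    norm_num
  have hqN' : ‖q‖ ^ 22 = ((23 : ℕ) : ℝ) ^ (-(2 : ℝ)) := by simpa using hqN
  -- the negative cell refutes reading (a) for every `c > 2`
  exact not_hStarI06OfHeightLt_of_cell 23 (RescaledCompletion (CyclotomicField 23 ℚ) 23 v hv) (k := 5) (by norm_num) (by norm_num)
    (H := 2) (by norm_num) hc hq0 hqN (j := 5) le_rfl
    (by simpa using cell_23_22_22_2_25_not_mem (RescaledCompletion (CyclotomicField 23 ℚ) 23 v hv) heK hqN')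

/-- **Reading (a) of the harvested row 8 is FALSE at its own bound `c = 4`, unconditionally.** [claim: Mochizuki2012, status: disputed] -/
theorem not_hStarI06OfHeightLt_four : ¬ HStarI06OfHeightLt 4 := not_hStarI06OfHeightLt_of_two_lt (by norm_num)

end Summit.ABC.IUTFork.Repair.RH.DatumClassHLt4

end
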